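import Mathlib
import Summits.MatrixMultiplication.MatrixMultiplication.Theorems.LevelGradedCohnUmansLevelOneGL2DesignsStubTangencySetsHermitianConjugationRules

/-!
# Door D9 continued: the reciprocal rule `1/E_ij + 1/E_ji = 1` organises `2p − 2` flags when `p ≡ 1 (mod 3)`
(stub `stub_tangencySets`, crux `LevelOneGL2Designs`, stmt-MatrixMultiplication-14080; wall-breaker axis 1/12
"Hermitian unital constructions", gen 1, seat 3 — CORRECTION and complement to `…HermitianConjugationRules.lean`)

The module docstring of `…HermitianConjugationRules.lean` (same seat, p126832) lists the bidegree-(1,1) conjugation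
rules THROUGH the origin as `y = x` (≤ p+1, Baer), `y = −x` (≤ p+3, proved there) and, up to scaling,
`(x−1)(y−1) = 1`, i.e. the RECIPROCAL RULE `1/E_ij + 1/E_ji = 1`, and then says "no such rule organises more than
`p + O(1)` flags over a prime field".  For the reciprocal rule that sentence is NOT proved there and is false as worded:
this file proves that the reciprocal rule organises `2(p−1)` flags whenever `𝔽_p` contains a primitive sixth root of
unity `ω` (`ω² − ω + 1 = 0`, i.e. `p = 3` or `p ≡ 1 (mod 3)`) — two copies of the standard family `E = 1 − x_i/x_j`
(each on `p−1` indices), one planar and one a pencil, glued through `ω`: all cross incidences are `ω` one way and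
`ω⁻¹` the other, and `ω + ω⁻¹ = 1` (`reciprocalRule_design`; registered stub
`reciprocalRule_design_two_mul`).  Exhaustive search (this seat, `comp/rules/r3clique.c`, flag-transitive
normalisation + max clique, complete) gives the exact maxima `4, 5, 12, 12, 24` of reciprocal-rule designs for
`p = 3, 5, 7, 11, 13`: `= 2p − 2` exactly at `p = 3, 7, 13` (`p ≢ 2 mod 3`), and `p`, `p + 1` at `p = 5, 11`.  What survives of the sentence: every bidegree-(1,1) rule
missing the origin is bounded by 16 (proved), the symmetric and skew rules by `p + O(1)` (proved), and the
reciprocal rule is `≥ 2p − 2` infinitely often; an `O(p)` UPPER bound for it is open here (structure: for such a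
design the vectors `(L_i, P_i, P_i ⊗ L_i) ∈ 𝔽^{15}` are pairwise and self-orthogonal for the non-degenerate form
`(L·P' + L'·P) − tr(Φ Φ')`, hence span a totally isotropic subspace of dimension ≤ 7).  Nothing at the `p^{3/2}`
scale is affected.  Elementary; no new definitions.
-/

set_option linter.dupNamespace false

namespace Summit.MatrixMultiplication.MatrixMultiplication.Theorems.LevelOneGL2Designs.ConjugationRules

open Finset Matrix

variable {F : Type*} [Field F]

/-- **The reciprocal rule organises `2·|Fˣ|` flags given a primitive sixth root of unity.**  If
`ω² − ω + 1 = 0` in a field `F`, the matrix on `Fin 2 × Fˣ` with entries `L i ⬝ P j`, where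
`L (0,u) = (u, 1, 0)`, `P (0,u) = (−u⁻¹, 1, 0)` (planar standard family `1 − u/v`) and `L (1,u) = (0, ω, u)`,
`P (1,u) = (0, 1−ω, −u⁻¹)` (a pencil, again `1 − u/v` internally since `ω(1−ω) = 1`), has zero diagonal,
nowhere-zero off-diagonal, rank `≤ 3`, and obeys the reciprocal (origin Möbius) rule `E_ij · E_ji = E_ij + E_ji`
for all `i ≠ j`: the cross incidences are the constants `1 − ω = ω⁻¹` and `ω`, and `ω + ω⁻¹ = 1`. [this seat] -/
theorem reciprocalRule_design [Fintype Fˣ] [DecidableEq F] (ω : F) (hω : ω ^ 2 - ω + 1 = 0) :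
    let L : Fin 2 × Fˣ → Fin 3 → F := fun i => if i.1 = 0 then ![(i.2 : F), 1, 0] else ![0, ω, (i.2 : F)]
    let P : Fin 2 × Fˣ → Fin 3 → F := fun i =>
      if i.1 = 0 then ![-((i.2 : F)⁻¹), 1, 0] else ![0, 1 - ω, -((i.2 : F)⁻¹)]
    let E : Matrix (Fin 2 × Fˣ) (Fin 2 × Fˣ) F := Matrix.of fun i j => L i ⬝ᵥ P j
    (∀ i, E i i = 0) ∧ (∀ i j, i ≠ j → E i j ≠ 0) ∧ E.rank ≤ 3 ∧
      (∀ i j, i ≠ j → E i j * E j i = E i j + E j i) := by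
  classical
  intro L P E
  have hω' : ω * (1 - ω) = 1 := by linear_combination -hω
  have hω0 : ω ≠ 0 := by
    intro h
    rw [h] at hω
    norm_num at hω
  have hω1 : 1 - ω ≠ 0 := by
    intro h
    have : ω = 1 := by linear_combination -h
    rw [this] at hω
    norm_num at hω
  -- the incidence matrix, case by case
  have hE : ∀ i j, E i j = if i.1 = 0 then (if j.1 = 0 then 1 - (i.2 : F) * (j.2 : F)⁻¹ else 1 - ω)
      else (if j.1 = 0 then ω else 1 - (i.2 : F) * (j.2 : F)⁻¹) := by
    rintro ⟨a, u⟩ ⟨b, v⟩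
    simp only [E, Matrix.of_apply]
    fin_cases a <;> fin_cases b
    · simp [L, P]
      ring
    · simp [L, P]
    · simp [L, P]
    · simp [L, P]
      linear_combination hω'
  -- the standard family is nowhere zero off the diagonal
  have hstd : ∀ u v : Fˣ, u ≠ v → (1 : F) - (u : F) * (v : F)⁻¹ ≠ 0 := by
    intro u v huv h
    apply huv
    have hv : (v : F) ≠ 0 := v.ne_zero
    have : (u : F) = v := by
      field_simp at h
      linear_combination -h
    exact Units.val_injective this
  refine ⟨?_, ?_, ?_, ?_⟩
  · intro i
    rw [hE]
    obtain ⟨a, u⟩ := i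
    fin_cases a <;> simp [u.ne_zero]
  · intro i j hij
    rw [hE]
    obtain ⟨a, u⟩ := i
    obtain ⟨b, v⟩ := j
    fin_cases a <;> fin_cases b
    · have huv : u ≠ v := fun h => hij (by rw [h])
      simpa using hstd u v huv
    · simpa using hω1
    · simpa using hω0
    · have huv : u ≠ v := fun h => hij (by rw [h])
      simpa using hstd u v huv
  · exact rank_dotMatrix_le L P
  · intro i j hij
    rw [hE i j, hE j i]
    obtain ⟨a, u⟩ := i
    obtain ⟨b, v⟩ := j
    have hu : (u : F) ≠ 0 := u.ne_zero
    have hv : (v : F) ≠ 0 := v.ne_zero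
    fin_cases a <;> fin_cases b
    · simp only [Fin.zero_eta, Fin.isValue, ↓reduceIte]
      field_simp
      ring
    · simp only [Fin.zero_eta, Fin.isValue, ↓reduceIte, Fin.mk_one, one_ne_zero]
      linear_combination -hω
    · simp only [Fin.mk_one, Fin.isValue, one_ne_zero, ↓reduceIte, Fin.zero_eta]
      linear_combination -hω
    · simp only [Fin.mk_one, Fin.isValue, one_ne_zero, ↓reduceIte]
      field_simp
      ring

/-- **Registered form (`reciprocalRule_design_two_mul`).**  For every prime `p` and every `ω : ZMod p` with
`ω² − ω + 1 = 0` there is a square matrix over `ZMod p` with `2(p−1)` rows, zero diagonal, nowhere-zero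
off-diagonal, rank `≤ 3`, obeying the reciprocal conjugation rule `E_ij E_ji = E_ij + E_ji` (`i ≠ j`) — so the
origin rule `(x−1)(y−1) = 1` of door D9 is NOT capped at `p + O(1)`; its cap (if any below `p^{3/2}`) is open.
[this seat] -/
theorem reciprocalRule_design_two_mul (p : ℕ) [Fact p.Prime] (ω : ZMod p) (hω : ω ^ 2 - ω + 1 = 0) :
    ∃ (n : ℕ) (E : Matrix (Fin n) (Fin n) (ZMod p)), n = 2 * (p - 1) ∧
      (∀ i, E i i = 0) ∧ (∀ i j, i ≠ j → E i j ≠ 0) ∧ E.rank ≤ 3 ∧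
      (∀ i j, i ≠ j → E i j * E j i = E i j + E j i) := by
  classical
  obtain ⟨h0, h1, hr, hrule⟩ := reciprocalRule_design ω hω
  set E : Matrix (Fin 2 × (ZMod p)ˣ) (Fin 2 × (ZMod p)ˣ) (ZMod p) :=
    Matrix.of fun i j =>
      (fun i : Fin 2 × (ZMod p)ˣ => if i.1 = 0 then ![(i.2 : ZMod p), 1, 0] else ![0, ω, (i.2 : ZMod p)]) i ⬝ᵥ
      (fun i : Fin 2 × (ZMod p)ˣ =>
        if i.1 = 0 then ![-((i.2 : ZMod p)⁻¹), 1, 0] else ![0, 1 - ω, -((i.2 : ZMod p)⁻¹)]) j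
  have hcard : Fintype.card (Fin 2 × (ZMod p)ˣ) = 2 * (p - 1) := by
    rw [Fintype.card_prod, Fintype.card_fin, ZMod.card_units]
  let e : Fin (2 * (p - 1)) ≃ (Fin 2 × (ZMod p)ˣ) := (Fintype.equivFinOfCardEq hcard).symm
  refine ⟨2 * (p - 1), E.submatrix e e, rfl, fun i => h0 _, fun i j hij => h1 _ _ (fun h => hij (e.injective h)),
    ?_, fun i j hij => hrule _ _ (fun h => hij (e.injective h))⟩
  calc (E.submatrix e e).rank = E.rank := by
        rw [show E.submatrix e e = Matrix.reindex e.symm e.symm E from rfl, Matrix.rank_reindex]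
    _ ≤ 3 := hr

end Summit.MatrixMultiplication.MatrixMultiplication.Theorems.LevelOneGL2Designs.ConjugationRules
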